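/-
Copyright: statement-level skeleton of a published paper (lit-balaban cell, Phase-2 proof seat p19, gen 3). No claims beyond
what the kernel checks below.
-/
import Mathlib
import Literature.MathematicalPhysics.QuantumFieldTheory.Balaban1983to89.B3Ineq213Points

/-!
# B3 — T. Bałaban, *(Higgs)₂,₃ quantum fields in a finite volume. III. Renormalization*, CMP **88** (1983) 411–445
[Balaban1983Higgs3] — p. 420 / p. 426: the tree length `d({□(v)}_{v∈G})` of (1.33)/(2.13) and the extraction of the
factor `exp[−½δ₁ d({□(v)})]` from the line decay factors of a connected graph

statement-level skeleton of published theorems with citation tags; proofs where landed; nothing here is a claim about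
the Yang–Mills mass gap

PDF held: `paper:balaban1983-higgs-2-3-quantum-fields-finite-volume` (journal page = PDF page + 410); displays read on
the ×2 renders `pub-balaban/b2b-balaban-ref1/pages/1983-cmp88-higgs23-III/1983-cmp88-higgs23-III-p010, p016-x2.png`
(pp. 420, 426).

Part of the Phase-2 proof of SKELETON row **B3.Eq2.13-2.14** (unit `lit-balaban-p19` gen 3, HOME
`run/shared/lean/pub/lit-balaban/`): files `B3Ineq213Points` → `B3Ineq213TreeLength` → `B3Ineq213Proof` (the theorem
`Amp.ineq213`), sub-namespace `…Balaban1983to89.B3Ineq213`.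

WHAT IS REPRODUCED.  p. 420 [PDF 10] (Proposition 1, (1.33)): *"d({□(v)}_{v∈G}) denotes a length of a shortest tree graph
connecting the vertices v localized in □(v), v ∈ G"*, and p. 426 [PDF 16] (the derivation of (2.13)): *"For each line we
extract a part of the exponential factors on the right sides of (2.5), (2.10), and (2.12) and we estimate them by
exp[−½δ₁dist(□(v), □(v′))], where □(v), □(v′) are localizations of endpoints of the line. After all these operations we get
the following inequality: [(2.13), with the factor exp[−(δ₁/2) d({□(v)}_{v∈G})]]"* — KERNEL-CHECKED as the two facts
behind the displayed factor: (i) DEFINITION `treeLen ρ` = the length of a shortest tree graph connecting all the vertices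
for given edge lengths `ρ(u, w) ≥ 0` (the minimum over the CONNECTING edge sets `S ⊆ V × V` of `Σ_{(u,w)∈S} ρ(u,w)`; for
non-negative lengths this minimum is attained on a spanning tree, so it is the printed *"length of a shortest tree
graph"*), and `boxTreeLen L k □` = `d({□(v)}_{v∈G})`: the minimum over the localized positions `x_v ∈ □(v)` (lattice
points of the unit cubes `□(v)`, `η = L^{−k}`) of the tree length of the points `{x_v}` with `ρ(u, w) = η|x_u − x_w|_∞`;
(ii) THEOREM (`treeLen_le_sum_lines`, `boxTreeLen_le_sum_lines`): for a CONNECTED graph `G` (Proposition 2.1 p. 424: *"Let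
G be a connected graph"*) and every admissible position tuple, `d({□(v)}) ≤ Σ_{lines l} η|x_{v_l} − x_{v′_l}|_∞` — whence
`Π_l exp[−½δ₁|x_{v_l} − x_{v′_l}|] ≤ exp[−½δ₁ d({□(v)})]`, the factor of (2.13) (`exp_sum_lines_le`).  Reading choice:
sup-norm distances on `ηℤ^d` as in the gen-2 files and `B3Ineq213Points` (a Euclidean tree length is ≥ this one, so the
printed factor is ≤ ours by at most the norm-equivalence constant in δ₁; the constants O(1), δ₀ of (1.33) *"depend on d
only"*).  Nothing of the paper beyond these two facts is asserted here.
-/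

open Finset

namespace Literature.MathematicalPhysics.QuantumFieldTheory.Balaban1983to89.B3Ineq213

open B3Ineq215

/-! ## (i) the tree length of a vertex configuration -/

section TreeLength

variable {V : Type*}

/-- An edge set `S ⊆ V × V` CONNECTS the vertex set: every two vertices are joined by a chain of edges of `S` (used in
either direction). [cite: Balaban1983Higgs3, (1.33) p.420] -/
def Connects (S : Finset (V × V)) : Prop := ∀ u w : V, Relation.EqvGen (fun a b => (a, b) ∈ S) u w

/-- A superset of a connecting edge set connects. [cite: Balaban1983Higgs3, (1.33) p.420] -/
theorem Connects.mono {S T : Finset (V × V)} (h : S ⊆ T) (hS : Connects S) : Connects T :=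
  fun u w => Relation.EqvGen.mono (fun _ _ hab => h hab) u w (hS u w)

/-- The lines `l(1), …, l(m)` of a graph (endpoints `src l`, `tgt l`) CONNECT its vertex set (Proposition 2.1 p. 424:
*"Let G be a connected graph"*). [cite: Balaban1983Higgs3, Prop. 2.1 p.424] -/
def LinesConnect {m : ℕ} (src tgt : Fin m → V) : Prop :=
  ∀ u w : V, Relation.EqvGen (fun a b => ∃ l, src l = a ∧ tgt l = b) u w

variable [Fintype V]

/-- The complete edge set connects. [cite: Balaban1983Higgs3, (1.33) p.420] -/
theorem connects_univ : Connects (Finset.univ : Finset (V × V)) :=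
  fun u w => Relation.EqvGen.rel u w (mem_univ _)

/-- The connecting edge sets (a finite, nonempty family). [cite: Balaban1983Higgs3, (1.33) p.420] -/
noncomputable def connSets : Finset (Finset (V × V)) := by
  classical exact Finset.univ.filter Connects

/-- Membership in `connSets`. [cite: Balaban1983Higgs3, (1.33) p.420] -/
theorem mem_connSets {S : Finset (V × V)} : S ∈ (connSets : Finset (Finset (V × V))) ↔ Connects S := by
  unfold connSets
  simp

/-- `connSets` is nonempty (it contains the complete edge set). [cite: Balaban1983Higgs3, (1.33) p.420] -/
theorem connSets_nonempty : (connSets : Finset (Finset (V × V))).Nonempty :=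
  ⟨Finset.univ, mem_connSets.2 connects_univ⟩

/-- p. 420 [PDF 10]: *"a length of a shortest tree graph connecting the vertices"* for given edge lengths `ρ(u, w)`: the
minimum over the connecting edge sets `S` of `Σ_{(u,w)∈S} ρ(u, w)` (for `ρ ≥ 0` attained on a spanning tree).
[cite: Balaban1983Higgs3, (1.33) p.420] -/
noncomputable def treeLen (ρ : V → V → ℝ) : ℝ :=
  (connSets : Finset (Finset (V × V))).inf' connSets_nonempty fun S => ∑ e ∈ S, ρ e.1 e.2

/-- The tree length is at most the total length of ANY connecting edge set. [cite: Balaban1983Higgs3, (1.33) p.420] -/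
theorem treeLen_le_of_connects (ρ : V → V → ℝ) {S : Finset (V × V)} (hS : Connects S) :
    treeLen ρ ≤ ∑ e ∈ S, ρ e.1 e.2 :=
  Finset.inf'_le (fun T : Finset (V × V) => ∑ e ∈ T, ρ e.1 e.2) (mem_connSets.2 hS)

/-- The tree length of non-negative edge lengths is non-negative. [cite: Balaban1983Higgs3, (1.33) p.420] -/
theorem treeLen_nonneg {ρ : V → V → ℝ} (hρ : ∀ u w, 0 ≤ ρ u w) : 0 ≤ treeLen ρ :=
  Finset.le_inf' _ _ fun _ _ => sum_nonneg fun e _ => hρ e.1 e.2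

/-- p. 426: for a connected graph the sum over ITS lines of the (non-negative) edge lengths dominates the length of the
shortest tree graph connecting the vertices — the step *"For each line we extract a part of the exponential factors … and we
estimate them by exp[−½δ₁dist(□(v), □(v′))]"* ⇒ the factor `exp[−(δ₁/2)d({□(v)})]` of (2.13).
[cite: Balaban1983Higgs3, (2.13) p.426] -/
theorem treeLen_le_sum_lines {m : ℕ} {src tgt : Fin m → V} (h : LinesConnect src tgt) {ρ : V → V → ℝ}
    (hρ : ∀ u w, 0 ≤ ρ u w) : treeLen ρ ≤ ∑ l, ρ (src l) (tgt l) := by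
  classical
  have hS : Connects ((Finset.univ : Finset (Fin m)).image fun l => (src l, tgt l)) := by
    intro u w
    refine Relation.EqvGen.mono ?_ u w (h u w)
    rintro a b ⟨l, ha, hb⟩
    exact mem_image.2 ⟨l, mem_univ _, by rw [ha, hb]⟩
  calc treeLen ρ ≤ ∑ e ∈ (Finset.univ : Finset (Fin m)).image (fun l => (src l, tgt l)), ρ e.1 e.2 :=
        treeLen_le_of_connects ρ hS
    _ ≤ ∑ l, ρ (src l) (tgt l) :=
        Finset.sum_image_le_of_nonneg (f := fun e : V × V => ρ e.1 e.2) fun e _ => hρ e.1 e.2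

end TreeLength

/-! ## (ii) `d({□(v)}_{v∈G})` for vertices localized in unit cubes of the η-lattice -/

section Boxes

variable {d : ℕ} {V : Type*}

/-- The edge lengths of a position tuple: `ρ_x(u, w) = η|x_u − x_w|_∞`, `η = L^{−k}` (positions in η-units).
[cite: Balaban1983Higgs3, (1.33) p.420] -/
noncomputable def edgeLen (L k : ℕ) (x : V → Fin d → ℕ) (u w : V) : ℝ :=
  ((L : ℝ) ^ k)⁻¹ * (supDist (x u) (x w) : ℝ)

/-- Edge lengths are non-negative. [cite: Balaban1983Higgs3, (1.33) p.420] -/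
theorem edgeLen_nonneg (L k : ℕ) (x : V → Fin d → ℕ) (u w : V) : 0 ≤ edgeLen L k x u w := by
  unfold edgeLen
  positivity

variable [Fintype V] [DecidableEq V]

/-- The admissible position tuples: `x_v` a lattice point of the unit cube `□(v)` (scale `k`, side `L^kη = 1`, position
`box v`), for every vertex `v` (p. 420: the vertices are *"localized in □(v)"*). [cite: Balaban1983Higgs3, (1.33) p.420] -/
def boxPositions (L k : ℕ) (box : V → Fin d → ℕ) : Finset (V → Fin d → ℕ) :=
  Fintype.piFinset fun v => pts L (⟨k, box v⟩ : Cube d)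

/-- Membership in `boxPositions`. [cite: Balaban1983Higgs3, (1.33) p.420] -/
theorem mem_boxPositions {L k : ℕ} {box : V → Fin d → ℕ} {x : V → Fin d → ℕ} :
    x ∈ boxPositions L k box ↔ ∀ v, x v ∈ pts L (⟨k, box v⟩ : Cube d) :=
  Fintype.mem_piFinset

/-- There are admissible position tuples (`L ≥ 1`). [cite: Balaban1983Higgs3, (1.33) p.420] -/
theorem boxPositions_nonempty {L : ℕ} (hL : 0 < L) (k : ℕ) (box : V → Fin d → ℕ) :
    (boxPositions L k box).Nonempty :=
  Fintype.piFinset_nonempty.2 fun _ => pts_nonempty hL _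

/-- **`d({□(v)}_{v∈G})`** of (1.33) p. 420 / (2.13) p. 426, verbatim: *"a length of a shortest tree graph connecting the
vertices v localized in □(v), v ∈ G"* — the minimum over the localized positions `x_v ∈ □(v)` of the tree length of the
points `{x_v}` (edge lengths `η|x_u − x_w|_∞`; the minimum of a finite set of reals, `0` if there are no positions).
[cite: Balaban1983Higgs3, (1.33) p.420] -/
noncomputable def boxTreeLen (L k : ℕ) (box : V → Fin d → ℕ) : ℝ :=
  sInf ((fun x => treeLen (edgeLen L k x)) '' (boxPositions L k box : Set (V → Fin d → ℕ)))

/-- `d({□(v)})` is at most the tree length of every admissible position tuple. [cite: Balaban1983Higgs3, (1.33) p.420] -/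
theorem boxTreeLen_le_treeLen {L k : ℕ} {box : V → Fin d → ℕ} {x : V → Fin d → ℕ} (hx : x ∈ boxPositions L k box) :
    boxTreeLen L k box ≤ treeLen (edgeLen L k x) :=
  csInf_le (((boxPositions L k box).finite_toSet.image _).bddBelow) ⟨x, mem_coe.2 hx, rfl⟩

/-- `d({□(v)}) ≥ 0`. [cite: Balaban1983Higgs3, (1.33) p.420] -/
theorem boxTreeLen_nonneg (L k : ℕ) (box : V → Fin d → ℕ) : 0 ≤ boxTreeLen L k box := by
  refine Real.sInf_nonneg ?_
  rintro _ ⟨x, _, rfl⟩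
  exact treeLen_nonneg fun u w => edgeLen_nonneg L k x u w

/-- p. 426, the extraction step behind the factor `exp[−(δ₁/2)d({□(v)}_{v∈G})]` of **(2.13)**: for a connected graph and
every position tuple `x_v ∈ □(v)`, `d({□(v)}) ≤ η Σ_{lines l} |x_{v_l} − x_{v′_l}|_∞`.
[cite: Balaban1983Higgs3, (2.13) p.426] -/
theorem boxTreeLen_le_sum_lines {L k : ℕ} {box : V → Fin d → ℕ} {m : ℕ} {src tgt : Fin m → V}
    (h : LinesConnect src tgt) {x : V → Fin d → ℕ} (hx : x ∈ boxPositions L k box) :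
    boxTreeLen L k box ≤ ((L : ℝ) ^ k)⁻¹ * ∑ l, (supDist (x (src l)) (x (tgt l)) : ℝ) := by
  calc boxTreeLen L k box ≤ treeLen (edgeLen L k x) := boxTreeLen_le_treeLen hx
    _ ≤ ∑ l, edgeLen L k x (src l) (tgt l) := treeLen_le_sum_lines h fun u w => edgeLen_nonneg L k x u w
    _ = ((L : ℝ) ^ k)⁻¹ * ∑ l, (supDist (x (src l)) (x (tgt l)) : ℝ) := by
        unfold edgeLen
        rw [Finset.mul_sum]

/-- The same as a bound on the exponential factors: `exp[−δ η Σ_l |x_{v_l} − x_{v′_l}|_∞] ≤ exp[−δ d({□(v)})]` for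
`δ ≥ 0`. [cite: Balaban1983Higgs3, (2.13) p.426] -/
theorem exp_sum_lines_le {L k : ℕ} {box : V → Fin d → ℕ} {m : ℕ} {src tgt : Fin m → V}
    (h : LinesConnect src tgt) {x : V → Fin d → ℕ} (hx : x ∈ boxPositions L k box) {δ : ℝ} (hδ : 0 ≤ δ) :
    Real.exp (-(δ * (((L : ℝ) ^ k)⁻¹ * ∑ l, (supDist (x (src l)) (x (tgt l)) : ℝ))))
      ≤ Real.exp (-(δ * boxTreeLen L k box)) := by
  apply Real.exp_le_exp.2
  have h1 := boxTreeLen_le_sum_lines (L := L) (k := k) (box := box) h hx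
  nlinarith

end Boxes

end Literature.MathematicalPhysics.QuantumFieldTheory.Balaban1983to89.B3Ineq213
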